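import Summits.BirchSwinnertonDyer.BirchSwinnertonDyer.Theorems.AlignedTransportAtTwoBSDOfMainConjectureRankOneAtTwoEulerCharAtTwoAssembly
import Summits.BirchSwinnertonDyer.BirchSwinnertonDyer.Theorems.AlignedTransportAtTwoBSDOfMainConjectureRankOneAtTwoEulerCharAtTwo
import Literature.NumberTheory.EllipticCurves.IwasawaTowerTorsionProofs
import Literature.NumberTheory.EllipticCurves.SelmerCorankProofs
import Literature.NumberTheory.EllipticCurves.SubgroupSelmerProofs
import Literature.NumberTheory.EllipticCurves.PointDivisibilityProofs
import HarnessLib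

/-!
# Route `AlignedTransportAtTwo`, crux C3′ `BSDOfMainConjectureRankOneAtTwo` (stmt-BirchSwinnertonDyer-23008), line `birth` v5:
# the Kummer instance of the positive-rank assembly; at `p = 2` on the C3′ cell, `Ш` CANCELS OUT of the one open obligation

HONEST FRAMING (cell `bsd-f1-sign2`, attach seat `bsd-line-att-p4` g7 under the C3′ lead lineage `bsd-line-att-p1`;
`--supports stmt-BirchSwinnertonDyer-23008 --as helper`). BSD is NOT proved; C3′ is NOT closed; nothing is asserted. THEOREMS ONLY
(no `def`, no named fact, no `sorry`). Companion of `…Theorems.AlignedTransportAtTwoEulerCharAtTwoAssembly` (§1–§2 there).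

* §3 (every `p`, every `ℤ_p`-extension of a number field): `Sel_{p^∞}(E/K) ≃+ Sel_{p^∞}(E/K_0)` by restriction
  (`exists_selmerLayerZero_addEquiv`); the Kummer map INTO the Selmer group, injective with `#coker = #Ш(E/K)[p^∞]`
  (`exists_kummerToSelmer`: the tree's Kummer sequence `kummerMapPInfty_injective` / `range_kummerMapPInfty` /
  `map_primaryH1ToH1_selmerGroupPInfty`, divisibility by `zsmul_geomPoints_surjective_holds`); and, for `θ = φ_{Sel} ∘ e ∘ s₀ ∘ e₀ ∘ κ` with
  ANY injection `κ : M ↪ Sel_{p^∞}(E/K)` of cokernel order `#Ш[p^∞]`: **`#ker θ·#Ш[p^∞]·#(A₀/Sel₀)·#ker φ_X = #coker φ_X·#ker h₀·#coker θ`**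
  (`finite_and_natCard_derivedKummerMap`) and **`[T^{ord f}] f·#ker h₀·#coker θ = u·#ker θ·#Ш[p^∞]·#(A₀/Sel₀)`**
  (`coeff_charGenerator_mul_card_derivedKummerMap`).
* §4 (`p = 2`, `W/ℚ` globally minimal, `IsOrdinaryAt W 2`, `E(ℚ)[2] = 0`; then `#ker h₀ = #E(ℚ)(2) = 1` and `ker g₀` is finite — tree
  theorems valid at `2`): per datum, att-p4 g6's Euler-characteristic VALUE conclusion (p624996: `ker φ_X` finite and
  `#coker φ_X·(log₂5)^r·#E(ℚ)(2)² = u·#ker φ_X·Reg₂·#Ш(2)·2^{v₂(∏c)}·#Ẽ(𝔽₂)(2)²`) holds IFF `θ` has finite kernel and cokernel and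
  **`#ker θ·#(A₀/Sel₀)·(log₂5)^r = u·#coker θ·Reg₂·2^{v₂(∏c)}·#Ẽ(𝔽₂)(2)²`**, same unit (`eulerCharAt_iff_shaFreeAt`); hence
  **`SchneiderLeadingTermFormulaAtTwoSqAt W`, the open stub of C3′ at a cell curve, is EQUIVALENT to a statement in which `Ш(E/ℚ)` occurs
  only through its finiteness** (`schneiderLeadingTermFormulaAtTwoSqAt_iff_shaFreeAt`, via p624996's `…_iff_eulerCharAt`).

READING (nothing registered by me; lead's call). Curve by curve the non-PRINT obligation of C3′ at `2` is the product of two indices of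
ONE explicit map `θ : E(ℚ) ⊗ ℚ₂/ℤ₂ → H¹(Γ, Sel_{2^∞}(E/ℚ_∞))` and of Greenberg's `A₀/Sel₀ ⊆ ker r₀`: (L) `#(A₀/Sel₀)` against
`2^{v₂(∏c_v)}·#Ẽ(𝔽₂)(2)²` (Greenberg Lemmas 4.4 × 4.7: local indices, PRINT at every `p`, plus Cassels–Poitou–Tate); (H) `#coker θ/#ker θ`
against `Reg₂/(log₂5)^r` («the derived/Bockstein pairing IS the canonical `Σ²` height», Perrin-Riou 1992 §3.4 / Schneider 1985; not in
print at `2` over `ℚ`, LTYZ 2025 §1.2). `Ш` is no longer part of it.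

References: [GreenbergLNM1716] §1 pp. 54–62, §3 Lemmas 3.3–3.5, §4 Thm. 4.1, Lemmas 4.2–4.7; [CoatesSchneiderSujatha2003] §3 (30)–(31), p. 204;
[PerrinRiou1992] §3.4; [Schneider1985]; [BalakrishnanMullerStein2015] Thm. 1.7 (3); [LiTianYanZhu2025] §1.2.
bears_on: stmt-BirchSwinnertonDyer-23008 (helper; closes nothing), stmt-BirchSwinnertonDyer-22298 (attach seat's item; untouched).
-/

set_option autoImplicit false
-- the route's Theorems namespace repeats a component by design (summit = sub-problem, D-0017).
set_option linter.dupNamespace false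

noncomputable section

open scoped Classical

universe u

open Summit.BirchSwinnertonDyer.BirchSwinnertonDyer.Theorems.AlignedTransportAtTwoEulerCharAtTwoAssembly

namespace Summit.BirchSwinnertonDyer.BirchSwinnertonDyer.Theorems.AlignedTransportAtTwoEulerCharAtTwoAssemblyKummer

/-! ## §3 The Kummer instance: `ι = E(K) ⊗ ℚ_p/ℤ_p ↪ Sel_{p^∞}(E/K) ≅ Sel_0`, cokernel `Ш(E/K)[p^∞]` -/
section Kummer

open Literature.NumberTheory.EllipticCurves Literature.NumberTheory.EllipticCurves.IwasawaAlgebra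
  Literature.NumberTheory.EllipticCurves.IwasawaDual WeierstrassCurve
open scoped TensorProduct

variable {K : Type u} [Field K] [NumberField K] (W : WeierstrassCurve K) {p : ℕ} [Fact p.Prime]
  (κ : ZpExtension K p) {γ : Field.absoluteGaloisGroup K}

/-- **`Sel_{p^∞}(E/K) ≃+ Sel_{p^∞}(E/K_0)` BY RESTRICTION** along `Gal(K̄/K_0) = κ⁻¹(p⁰ℤ_p) = Γ_K` (`layerSubgroup_zero`): the tree's
`exists_addEquiv_selmerGroupOver_top` transported to the `0`-th layer. [cite: GreenbergLNM1716, §1 p. 60, §2] -/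
theorem exists_selmerLayerZero_addEquiv :
    ∃ e₀ : ↥(W.selmerGroupPInfty p) ≃+ ↥(W.selmerLayer κ 0),
      ∀ c : W.selmerGroupPInfty p, ((e₀ c : W.selmerLayer κ 0) : W.subgroupH1 p (κ.layerSubgroup 0)) =
        resH1Hom (subgroupIncl (κ.layerSubgroup 0)) (AddMonoidHom.id (geomPrimaryTorsion W p)) (fun _ _ ↦ rfl)
          (c : W.galH1Primary p) := by
  have key : ∀ (H : Subgroup (Field.absoluteGaloisGroup K)) [H.Normal], H = ⊤ →
      ∃ e₀ : ↥(W.selmerGroupPInfty p) ≃+ ↥(W.selmerGroupOver p H),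
        ∀ c : W.selmerGroupPInfty p, ((e₀ c : W.selmerGroupOver p H) : W.subgroupH1 p H) =
          resH1Hom (subgroupIncl H) (AddMonoidHom.id (geomPrimaryTorsion W p)) (fun _ _ ↦ rfl)
            (c : W.galH1Primary p) := by
    rintro H _ rfl
    obtain ⟨f, hf⟩ := W.exists_addEquiv_selmerGroupOver_top p
    exact ⟨f.symm, hf⟩
  exact key (κ.layerSubgroup 0) κ.layerSubgroup_zero

/-- **The `p^∞` Kummer map INTO the Selmer group, injective, `#coker = #Ш(E/K)[p^∞]`** — the tree's exact sequence
`0 → E(K) ⊗ ℚ_p/ℤ_p → Sel_{p^∞}(E/K) → Ш(E/K)[p^∞] → 0` (`kummerMapPInfty_injective`, `range_kummerMapPInfty`,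
`map_primaryH1ToH1_selmerGroupPInfty`; divisibility of `E(K̄)` by `zsmul_geomPoints_surjective_holds`) packaged as `Nat.card`s
(both sides `0` if infinite). [cite: GreenbergLNM1716, §1 p. 54, §2 pp. 62–63] -/
theorem exists_kummerToSelmer [W.IsElliptic] :
    ∃ kS : W.toAffine.Point ⊗[ℤ] PruferQuot p →+ ↥(W.selmerGroupPInfty p),
      (∀ t, ((kS t : W.selmerGroupPInfty p) : W.galH1Primary p) =
          kummerMapPInfty W p W.zsmul_geomPoints_surjective_holds t) ∧
      Function.Injective kS ∧
      Nat.card (↥(W.selmerGroupPInfty p) ⧸ kS.range) = Nat.card (AddCommGroup.primaryComponent W.sha p) := by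
  have hdiv : W.zsmul_geomPoints_surjective := W.zsmul_geomPoints_surjective_holds
  have hle : (kummerMapPInfty W p hdiv).range ≤ W.selmerGroupPInfty p := by
    rw [range_kummerMapPInfty]; exact ker_primaryH1ToH1_le_selmerGroupPInfty W p
  refine ⟨(kummerMapPInfty W p hdiv).codRestrict (W.selmerGroupPInfty p) (fun t ↦ hle ⟨t, rfl⟩), fun _ ↦ rfl,
    ?_, ?_⟩
  · intro a b h
    exact kummerMapPInfty_injective W p hdiv (congrArg Subtype.val h)
  · -- `Sel → H¹(K, E)`: kernel `= im κ`, image `= Ш[p^∞]`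
    have hker : ((primaryH1ToH1 W p).comp (W.selmerGroupPInfty p).subtype).ker =
        ((kummerMapPInfty W p hdiv).codRestrict (W.selmerGroupPInfty p) (fun t ↦ hle ⟨t, rfl⟩)).range := by
      ext x
      rw [AddMonoidHom.mem_ker, AddMonoidHom.comp_apply, AddSubgroup.coe_subtype, ← AddMonoidHom.mem_ker,
        ← range_kummerMapPInfty W p hdiv, AddMonoidHom.mem_range, AddMonoidHom.mem_range]
      constructor
      · rintro ⟨t, ht⟩
        exact ⟨t, Subtype.ext ht⟩
      · rintro ⟨t, ht⟩
        exact ⟨t, congrArg Subtype.val ht⟩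
    have hrange : ((primaryH1ToH1 W p).comp (W.selmerGroupPInfty p).subtype).range =
        (AddCommGroup.primaryComponent W.sha p).map W.sha.subtype := by
      rw [AddMonoidHom.range_comp, AddSubgroup.range_subtype, map_primaryH1ToH1_selmerGroupPInfty W p hdiv]
    rw [← hker, Nat.card_congr (QuotientAddGroup.quotientKerEquivRange _).toEquiv, hrange,
      ← Nat.card_congr (AddSubgroup.equivMapOfInjective _ _ W.sha.subtype_injective).toEquiv]

set_option maxHeartbeats 1000000 in
/-- **THE ASSEMBLY WITH `Ш` (every `p`, every `ℤ_p`-extension, every number field).** For `θ = φ_{Sel} ∘ e ∘ s₀ ∘ e₀ ∘ κ : M →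
H¹(Γ, Sel_{p^∞}(E/K_∞))` (`κ : M ↪ Sel_{p^∞}(E/K)` any injection with cokernel of order `#Ш(E/K)[p^∞]`, finite — the Kummer map on
`E(K) ⊗ ℚ_p/ℤ_p` is one, `exists_kummerToSelmer`; `e₀`, `e` any additive identifications, canonically `exists_selmerLayerZero_addEquiv`,
`exists_invariantsZero_addEquiv`): if `E(K_∞)[p^∞]`, `ker g₀ = A₀/Sel₀` and `ker φ_X` are finite then `θ` has finite kernel and
cokernel and **`[T^{ord f}] f · #ker h₀ · #coker θ = u · #ker θ · #Ш(E/K)[p^∞] · #(A₀/Sel₀)`**, `u ∈ ℤ_pˣ`. For `rank E(K) = 0`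
this is the tree's rank-`0` assembly `f(0)·#(Sel_∞)_γ·#E[p^∞]^{Γ_K} = u·#Sel_{p^∞}(E/K)·#ker g₀`.
[cite: GreenbergLNM1716, §4 Thm. 4.1, Lemmas 4.2–4.7 (pp. 102–108)] [cite: CoatesSchneiderSujatha2003, §3 (30)–(31) p. 199, p. 204]
[cite: PerrinRiou1992, §3.4] -/
theorem coeff_charGenerator_mul_card_derivedKummerMap [W.IsElliptic] (hγ : κ.IsTopGenerator γ)
    (D : W.SelmerDualData κ γ) [Module.Finite (IwasawaAlgebra p) D.X] (hX : Module.IsTorsion (IwasawaAlgebra p) D.X)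
    (f : IwasawaAlgebra p) (hf : Module.charIdeal (IwasawaAlgebra p) D.X = Ideal.span {f})
    [Finite (FixedPoints.addSubgroup κ.kerSubgroup (geomPrimaryTorsion W p))] [Finite (W.KerG κ 0)]
    (hfin : Finite (LinearMap.ker (bockstein p D.X)))
    (e : ↥(W.selmerInfty κ ⊓ W.layerInvariants κ 0) ≃+ ↥(endInvariants (W.conjSelmerInfty κ γ - 1)))
    (e₀ : ↥(W.selmerGroupPInfty p) ≃+ ↥(W.selmerLayer κ 0))
    {M : Type*} [AddCommGroup M] (kS : M →+ ↥(W.selmerGroupPInfty p)) (hkS : Function.Injective kS)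
    (hkS' : Nat.card (↥(W.selmerGroupPInfty p) ⧸ kS.range) = Nat.card (AddCommGroup.primaryComponent W.sha p))
    (hSha : Finite (AddCommGroup.primaryComponent W.sha p))
    (θ : M →+ EndCoinvariants (W.conjSelmerInfty κ γ - 1))
    (hθ : θ = (W.selmerInftyEulerMap κ γ).comp
      (((e : ↥(W.selmerInfty κ ⊓ W.layerInvariants κ 0) →+ ↥(endInvariants (W.conjSelmerInfty κ γ - 1))).comp (W.sMap κ 0)).comp
        ((e₀ : ↥(W.selmerGroupPInfty p) →+ ↥(W.selmerLayer κ 0)).comp kS))) :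
    Finite θ.ker ∧ Finite (EndCoinvariants (W.conjSelmerInfty κ γ - 1) ⧸ θ.range) ∧
      ∃ u : ℤ_[p]ˣ,
        PowerSeries.coeff f.order.toNat f * (Nat.card (W.layerToInfty κ 0).ker : ℤ_[p]) *
            Nat.card (EndCoinvariants (W.conjSelmerInfty κ γ - 1) ⧸ θ.range) =
          u * Nat.card θ.ker * Nat.card (AddCommGroup.primaryComponent W.sha p) * Nat.card (W.KerG κ 0) := by
  -- `ι = e₀ ∘ κ`: injective, cokernel of order `#Ш[p^∞]`
  have hιker : ((e₀ : ↥(W.selmerGroupPInfty p) →+ ↥(W.selmerLayer κ 0)).comp kS).ker = ⊥ :=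
    (AddMonoidHom.ker_eq_bot_iff _).mpr (e₀.injective.comp hkS)
  have hιcard : Nat.card (↥(W.selmerLayer κ 0) ⧸ ((e₀ : ↥(W.selmerGroupPInfty p) →+ ↥(W.selmerLayer κ 0)).comp kS).range)
      = Nat.card (AddCommGroup.primaryComponent W.sha p) := by
    rw [← AddSubgroup.index_eq_card, AddMonoidHom.range_comp, AddSubgroup.index_map_equiv, AddSubgroup.index_eq_card,
      hkS']
  haveI hsub : Subsingleton ((e₀ : ↥(W.selmerGroupPInfty p) →+ ↥(W.selmerLayer κ 0)).comp kS).ker :=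
    ⟨fun a b ↦ Subtype.ext ((((e₀ : ↥(W.selmerGroupPInfty p) →+ ↥(W.selmerLayer κ 0)).comp kS).ker.eq_bot_iff_forall.mp hιker a a.2).trans
      ((((e₀ : ↥(W.selmerGroupPInfty p) →+ ↥(W.selmerLayer κ 0)).comp kS).ker.eq_bot_iff_forall.mp hιker b b.2).symm))⟩
  haveI : Finite ((e₀ : ↥(W.selmerGroupPInfty p) →+ ↥(W.selmerLayer κ 0)).comp kS).ker := Finite.of_subsingleton
  have hk1 : Nat.card ((e₀ : ↥(W.selmerGroupPInfty p) →+ ↥(W.selmerLayer κ 0)).comp kS).ker = 1 := by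
    haveI : Unique ((e₀ : ↥(W.selmerGroupPInfty p) →+ ↥(W.selmerLayer κ 0)).comp kS).ker := { default := 0, uniq := fun a ↦ Subsingleton.elim a 0 }
    exact Nat.card_unique
  haveI : Finite (↥(W.selmerLayer κ 0) ⧸ ((e₀ : ↥(W.selmerGroupPInfty p) →+ ↥(W.selmerLayer κ 0)).comp kS).range) := by
    apply Nat.finite_of_card_ne_zero; rw [hιcard]; haveI := hSha; exact Nat.card_pos.ne'
  have h := coeff_charGenerator_mul_card_derivedMap W κ hγ D hX f hf hfin e ((e₀ : ↥(W.selmerGroupPInfty p) →+ ↥(W.selmerLayer κ 0)).comp kS) θ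
  have h' := h hθ
  refine ⟨h'.1, h'.2.1, Exists.imp (fun u hu ↦ ?_) h'.2.2⟩
  rw [hιcard, hk1, Nat.cast_one, mul_one] at hu
  exact hu

set_option maxHeartbeats 1000000 in
/-- **THE DESCENT COUNT WITH `Ш` (Λ-free; every `p`, every `ℤ_p`-extension, every number field):** for `θ = φ_{Sel} ∘ e ∘ s₀ ∘ e₀ ∘ κ`
(`κ : M ↪ Sel_{p^∞}(E/K)` injective, cokernel of order `#Ш(E/K)[p^∞]`, finite), if `E(K_∞)[p^∞]`, `ker g₀`, `ker φ_X` are finite then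
`θ` has finite kernel and cokernel and **`#ker θ · #Ш(E/K)[p^∞] · #(A₀/Sel₀) · #ker φ_X = #coker φ_X · #ker h₀ · #coker θ`**.
[cite: GreenbergLNM1716, §4 Lemmas 4.2–4.3 (pp. 102–103)] [cite: CoatesSchneiderSujatha2003, §3 (30)–(31) p. 199] -/
theorem finite_and_natCard_derivedKummerMap [W.IsElliptic] (hγ : κ.IsTopGenerator γ)
    (D : W.SelmerDualData κ γ) [Module.Finite (IwasawaAlgebra p) D.X] (hX : Module.IsTorsion (IwasawaAlgebra p) D.X)
    [Finite (FixedPoints.addSubgroup κ.kerSubgroup (geomPrimaryTorsion W p))] [Finite (W.KerG κ 0)]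
    (hfin : Finite (LinearMap.ker (bockstein p D.X)))
    (e : ↥(W.selmerInfty κ ⊓ W.layerInvariants κ 0) ≃+ ↥(endInvariants (W.conjSelmerInfty κ γ - 1)))
    (e₀ : ↥(W.selmerGroupPInfty p) ≃+ ↥(W.selmerLayer κ 0))
    {M : Type*} [AddCommGroup M] (kS : M →+ ↥(W.selmerGroupPInfty p)) (hkS : Function.Injective kS)
    (hkS' : Nat.card (↥(W.selmerGroupPInfty p) ⧸ kS.range) = Nat.card (AddCommGroup.primaryComponent W.sha p))
    (hSha : Finite (AddCommGroup.primaryComponent W.sha p))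
    (θ : M →+ EndCoinvariants (W.conjSelmerInfty κ γ - 1))
    (hθ : θ = (W.selmerInftyEulerMap κ γ).comp
      (((e : ↥(W.selmerInfty κ ⊓ W.layerInvariants κ 0) →+ ↥(endInvariants (W.conjSelmerInfty κ γ - 1))).comp (W.sMap κ 0)).comp
        ((e₀ : ↥(W.selmerGroupPInfty p) →+ ↥(W.selmerLayer κ 0)).comp kS))) :
    Finite θ.ker ∧ Finite (EndCoinvariants (W.conjSelmerInfty κ γ - 1) ⧸ θ.range) ∧
      Nat.card θ.ker * Nat.card (AddCommGroup.primaryComponent W.sha p) * Nat.card (W.KerG κ 0) *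
          Nat.card (LinearMap.ker (bockstein p D.X)) =
        Nat.card (coinvariants p D.X ⧸ LinearMap.range (bockstein p D.X)) * Nat.card (W.layerToInfty κ 0).ker *
          Nat.card (EndCoinvariants (W.conjSelmerInfty κ γ - 1) ⧸ θ.range) := by
  have hιker : ((e₀ : ↥(W.selmerGroupPInfty p) →+ ↥(W.selmerLayer κ 0)).comp kS).ker = ⊥ :=
    (AddMonoidHom.ker_eq_bot_iff _).mpr (e₀.injective.comp hkS)
  have hιcard : Nat.card (↥(W.selmerLayer κ 0) ⧸ ((e₀ : ↥(W.selmerGroupPInfty p) →+ ↥(W.selmerLayer κ 0)).comp kS).range)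
      = Nat.card (AddCommGroup.primaryComponent W.sha p) := by
    rw [← AddSubgroup.index_eq_card, AddMonoidHom.range_comp, AddSubgroup.index_map_equiv, AddSubgroup.index_eq_card,
      hkS']
  haveI hsub : Subsingleton ((e₀ : ↥(W.selmerGroupPInfty p) →+ ↥(W.selmerLayer κ 0)).comp kS).ker :=
    ⟨fun a b ↦ Subtype.ext ((((e₀ : ↥(W.selmerGroupPInfty p) →+ ↥(W.selmerLayer κ 0)).comp kS).ker.eq_bot_iff_forall.mp hιker a a.2).trans
      ((((e₀ : ↥(W.selmerGroupPInfty p) →+ ↥(W.selmerLayer κ 0)).comp kS).ker.eq_bot_iff_forall.mp hιker b b.2).symm))⟩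
  haveI : Finite ((e₀ : ↥(W.selmerGroupPInfty p) →+ ↥(W.selmerLayer κ 0)).comp kS).ker := Finite.of_subsingleton
  have hk1 : Nat.card ((e₀ : ↥(W.selmerGroupPInfty p) →+ ↥(W.selmerLayer κ 0)).comp kS).ker = 1 := by
    haveI : Unique ((e₀ : ↥(W.selmerGroupPInfty p) →+ ↥(W.selmerLayer κ 0)).comp kS).ker := { default := 0, uniq := fun a ↦ Subsingleton.elim a 0 }
    exact Nat.card_unique
  haveI : Finite (↥(W.selmerLayer κ 0) ⧸ ((e₀ : ↥(W.selmerGroupPInfty p) →+ ↥(W.selmerLayer κ 0)).comp kS).range) := by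
    apply Nat.finite_of_card_ne_zero; rw [hιcard]; haveI := hSha; exact Nat.card_pos.ne'
  have h := finite_and_natCard_derivedMap W κ hγ D hX hfin e ((e₀ : ↥(W.selmerGroupPInfty p) →+ ↥(W.selmerLayer κ 0)).comp kS) θ
  have h' := h hθ
  refine ⟨h'.1, h'.2.1, ?_⟩
  have hN := h'.2.2
  rw [hιcard, hk1, mul_one] at hN
  exact hN

end Kummer


/-! ## §4 At `p = 2` over `ℚ` on the C3′ cell (`E(ℚ)[2] = 0`): the Euler-characteristic VALUE statement ⟺ its `Ш`-free form -/

section AtTwo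

open Literature.NumberTheory.EllipticCurves Literature.NumberTheory.EllipticCurves.IwasawaAlgebra
  Literature.NumberTheory.EllipticCurves.IwasawaDual WeierstrassCurve NumberField IsDedekindDomain

/-- `E(K)[p] = 0 ⇒ #E(K)[p^∞] = 1` (`p • P = 0 ⇒ P = 0`, iterated). [folklore] -/
theorem natCard_primaryComponent_point_eq_one_of_no_pTorsion {K : Type*} [Field K] (V : WeierstrassCurve K) (p : ℕ)
    [Fact p.Prime] (hK : ∀ P : V.toAffine.Point, p • P = 0 → P = 0) :
    Nat.card (AddCommGroup.primaryComponent V.toAffine.Point p) = 1 := by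
  have key : ∀ (n : ℕ) (P : V.toAffine.Point), p ^ n • P = 0 → P = 0 := by
    intro n
    induction n with
    | zero => intro P hP; simpa using hP
    | succ n ih =>
      intro P hP
      rw [pow_succ', mul_smul] at hP
      exact ih P (hK (p ^ n • P) hP)
  rw [Nat.card_eq_one_iff_unique]
  refine ⟨⟨fun a b ↦ ?_⟩, ⟨0⟩⟩
  obtain ⟨n, hn⟩ := (AddCommGroup.mem_primaryComponent (G := V.toAffine.Point) (p := p)).mp a.2
  obtain ⟨m, hm⟩ := (AddCommGroup.mem_primaryComponent (G := V.toAffine.Point) (p := p)).mp b.2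
  exact Subtype.ext ((key n _ hn).trans (key m _ hm).symm)

variable (W : WeierstrassCurve ℚ) [W.IsElliptic] [W.IsGloballyMinimal]

omit [W.IsGloballyMinimal] in
/-- `E(ℚ)[2] = 0 ⇒ #ker h₀ = #E[2^∞]^{Γ_ℚ} = 1` (tree: pro-`2` fixed-point principle, `natCard_fixedBy_layerSubgroup_eq_one`, and
Greenberg's `#ker h₀ = #E[p^∞]^{Gal(ℚ̄/ℚ_0)}`). [cite: GreenbergLNM1716, §1 p. 62, §4 Lemma 4.3] -/
theorem natCard_ker_layerToInfty_zero_eq_one_of_no_twoTorsion (hK : ∀ P : W.toAffine.Point, 2 • P = 0 → P = 0)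
    (κ : ZpExtension ℚ 2) : Nat.card (W.layerToInfty κ 0).ker = 1 := by
  -- `hK` restated over the generic-field instance path of the Literature lemmas (`DecidableEq ℚ` is a subsingleton)
  haveI := W.finite_fixedPoints_kerSubgroup_geomPrimaryTorsion κ (fun P hP ↦ hK P (by convert hP))
  rw [W.natCard_ker_layerToInfty_eq_natCard_fixedPoints κ 0,
    W.natCard_fixedBy_layerSubgroup_eq_one κ (fun P hP ↦ hK P (by convert hP)) 0]

/-- At a good ordinary prime `p` of `W/ℚ` (cyclotomic `κ`; `p = 2` allowed) Greenberg's `ker g₀ = A₀/Sel₀` is finite: the tree's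
Lemmas 3.3/3.5 at `n = 0` fed with Lemma 3.4 at `n = 0`. [cite: GreenbergLNM1716, §3 Lemmas 3.3–3.5 (pp. 86–90)] -/
theorem finite_kerG_zero_of_isOrdinaryAt {p : ℕ} [Fact p.Prime] (hord : IsOrdinaryAt W p) (κ : ZpExtension ℚ p)
    (hκ : κ.IsCyclotomic) : Finite (W.KerG κ 0) :=
  W.finite_kerG_zero_of_finite_localTowerKerPrimary_dvd κ fun _ hpv ↦
    W.finite_localTowerKerPrimary_zero_of_ordinary hpv
      (W.not_dvd_minimalDiscriminantInt_of_hasGoodReductionAtPrime' p hord.1) hord.2 κ hκ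

set_option maxHeartbeats 2000000 in
/-- **The `Γ`-Euler-characteristic VALUE statement at `2` ⟺ its `Ш`-FREE form, per datum** (`W/ℚ` globally minimal,
`IsOrdinaryAt W 2`, `E(ℚ)[2] = 0`; `κ` cyclotomic with topological generator `γ`; `X = D.X` finitely generated `Λ`-torsion; ANY
`2`-adic height datum `Dh`; `Ш(E/ℚ)(2)` finite; `θ = φ_{Sel} ∘ e ∘ s₀ ∘ e₀ ∘ κ` for ANY identifications `e`, `e₀` and ANY injection
`κ : M ↪ Sel_{2^∞}(E/ℚ)` with cokernel of order `#Ш(E/ℚ)(2)`). att-p4 g6's conclusion (p624996: `ker φ_X` finite and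
`#coker φ_X·(log₂5)^r·#E(ℚ)(2)² = u·#ker φ_X·Reg₂(Dh)·#Ш(2)·2^{v₂(∏c_v)}·#Ẽ(𝔽₂)(2)²`) holds IFF `θ` has finite kernel and cokernel and
**`#ker θ · #(A₀/Sel₀) · (log₂5)^r = u · #coker θ · Reg₂(Dh) · 2^{v₂(∏c_v)} · #Ẽ(𝔽₂)(2)²`** with THE SAME unit `u` — `Ш` enters only
through its finiteness (descent count §3 and `#ker h₀ = #E(ℚ)(2) = 1`). CONDITIONAL on nothing; closes nothing.
[cite: GreenbergLNM1716, §4 Thm. 4.1, Lemmas 4.2–4.7 (pp. 102–108)] [cite: CoatesSchneiderSujatha2003, p. 204 (Case 2), §3 (30)–(31) p. 199]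
[cite: PerrinRiou1992, §3.4] -/
theorem eulerCharAt_iff_shaFreeAt (hK : ∀ P : W.toAffine.Point, 2 • P = 0 → P = 0) (hord : IsOrdinaryAt W 2)
    {κ : ZpExtension ℚ 2} {γ : Field.absoluteGaloisGroup ℚ} (hκ : κ.IsCyclotomic) (hγ : κ.IsTopGenerator γ)
    (D : W.SelmerDualData κ γ) [Module.Finite (IwasawaAlgebra 2) D.X] (hX : D.IsTorsion)
    (Dh : PAdicHeightData W 2) (hSha : Finite (AddCommGroup.primaryComponent W.sha 2))
    (e : ↥(W.selmerInfty κ ⊓ W.layerInvariants κ 0) ≃+ ↥(endInvariants (W.conjSelmerInfty κ γ - 1)))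
    (e₀ : ↥(W.selmerGroupPInfty 2) ≃+ ↥(W.selmerLayer κ 0))
    {M : Type*} [AddCommGroup M] (kS : M →+ ↥(W.selmerGroupPInfty 2)) (hkS : Function.Injective kS)
    (hkS' : Nat.card (↥(W.selmerGroupPInfty 2) ⧸ kS.range) = Nat.card (AddCommGroup.primaryComponent W.sha 2))
    (θ : M →+ EndCoinvariants (W.conjSelmerInfty κ γ - 1))
    (hθ : θ = (W.selmerInftyEulerMap κ γ).comp
      (((e : ↥(W.selmerInfty κ ⊓ W.layerInvariants κ 0) →+ ↥(endInvariants (W.conjSelmerInfty κ γ - 1))).comp (W.sMap κ 0)).comp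
        ((e₀ : ↥(W.selmerGroupPInfty 2) →+ ↥(W.selmerLayer κ 0)).comp kS))) :
    (Finite (LinearMap.ker (bockstein 2 D.X)) ∧
      ∃ u : ℤ_[2]ˣ,
        (Nat.card (coinvariants 2 D.X ⧸ LinearMap.range (bockstein 2 D.X)) : ℚ_[2]) *
            padicLog 2 (cyclotomicGenerator 2) ^ W.mordellWeilRank *
            (Nat.card (AddCommGroup.primaryComponent W.toAffine.Point 2) : ℚ_[2]) ^ 2 =
          ((u : ℤ_[2]) : ℚ_[2]) * Nat.card (LinearMap.ker (bockstein 2 D.X)) * padicRegulator Dh *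
            Nat.card (AddCommGroup.primaryComponent W.sha 2) * (2 : ℚ_[2]) ^ (padicValNat 2 W.tamagawaProduct) *
            (Nat.card (AddCommGroup.primaryComponent
              ((integralModelInt W).map (Int.castRingHom (ZMod 2))).toAffine.Point 2) : ℚ_[2]) ^ 2) ↔
    (Finite θ.ker ∧ Finite (EndCoinvariants (W.conjSelmerInfty κ γ - 1) ⧸ θ.range) ∧
      ∃ u : ℤ_[2]ˣ,
        (Nat.card θ.ker : ℚ_[2]) * Nat.card (W.KerG κ 0) * padicLog 2 (cyclotomicGenerator 2) ^ W.mordellWeilRank =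
          ((u : ℤ_[2]) : ℚ_[2]) * Nat.card (EndCoinvariants (W.conjSelmerInfty κ γ - 1) ⧸ θ.range) * padicRegulator Dh *
            (2 : ℚ_[2]) ^ (padicValNat 2 W.tamagawaProduct) *
            (Nat.card (AddCommGroup.primaryComponent
              ((integralModelInt W).map (Int.castRingHom (ZMod 2))).toAffine.Point 2) : ℚ_[2]) ^ 2) := by
  haveI := W.finite_fixedPoints_kerSubgroup_geomPrimaryTorsion κ (fun P hP ↦ hK P (by convert hP))
  haveI := finite_kerG_zero_of_isOrdinaryAt W hord κ hκ
  haveI := hSha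
  have hkh : Nat.card (W.layerToInfty κ 0).ker = 1 := natCard_ker_layerToInfty_zero_eq_one_of_no_twoTorsion W hK κ
  have ht : Nat.card (AddCommGroup.primaryComponent W.toAffine.Point 2) = 1 := by
    have h := natCard_primaryComponent_point_eq_one_of_no_pTorsion W 2 (fun P hP ↦ hK P (by convert hP))
    convert h
  have hSha0 : (Nat.card (AddCommGroup.primaryComponent W.sha 2) : ℚ_[2]) ≠ 0 := by exact_mod_cast Nat.card_pos.ne'
  have hkg0 : (Nat.card (W.KerG κ 0) : ℚ_[2]) ≠ 0 := by exact_mod_cast Nat.card_pos.ne'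
  constructor
  · rintro ⟨hfin, u, hu⟩
    have h := finite_and_natCard_derivedKummerMap W κ hγ D hX hfin e e₀ kS hkS hkS' hSha θ hθ
    refine ⟨h.1, h.2.1, u, ?_⟩
    have hN : ((Nat.card θ.ker : ℕ) : ℚ_[2]) * Nat.card (AddCommGroup.primaryComponent W.sha 2) * Nat.card (W.KerG κ 0) *
        Nat.card (LinearMap.ker (bockstein 2 D.X)) =
        (Nat.card (coinvariants 2 D.X ⧸ LinearMap.range (bockstein 2 D.X)) : ℚ_[2]) * Nat.card (W.layerToInfty κ 0).ker *
        Nat.card (EndCoinvariants (W.conjSelmerInfty κ γ - 1) ⧸ θ.range) := by exact_mod_cast h.2.2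
    rw [hkh, Nat.cast_one, mul_one] at hN
    rw [ht, Nat.cast_one, one_pow, mul_one] at hu
    haveI := hfin
    have ha0 : (Nat.card (LinearMap.ker (bockstein 2 D.X)) : ℚ_[2]) ≠ 0 := by exact_mod_cast Nat.card_pos.ne'
    refine mul_right_cancel₀ (mul_ne_zero ha0 hSha0) ?_
    linear_combination (padicLog 2 (cyclotomicGenerator 2) ^ W.mordellWeilRank) * hN +
      (Nat.card (EndCoinvariants (W.conjSelmerInfty κ γ - 1) ⧸ θ.range) : ℚ_[2]) * hu
  · rintro ⟨hkθ, hcθ, u, hu⟩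
    have hfin : Finite (LinearMap.ker (bockstein 2 D.X)) :=
      finite_ker_bockstein_of_finite_coker_derivedMap W κ hγ D e ((e₀ : ↥(W.selmerGroupPInfty 2) →+ ↥(W.selmerLayer κ 0)).comp kS) θ hθ hcθ
    have h := finite_and_natCard_derivedKummerMap W κ hγ D hX hfin e e₀ kS hkS hkS' hSha θ hθ
    refine ⟨hfin, u, ?_⟩
    have hN : ((Nat.card θ.ker : ℕ) : ℚ_[2]) * Nat.card (AddCommGroup.primaryComponent W.sha 2) * Nat.card (W.KerG κ 0) *
        Nat.card (LinearMap.ker (bockstein 2 D.X)) =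
        (Nat.card (coinvariants 2 D.X ⧸ LinearMap.range (bockstein 2 D.X)) : ℚ_[2]) * Nat.card (W.layerToInfty κ 0).ker *
        Nat.card (EndCoinvariants (W.conjSelmerInfty κ γ - 1) ⧸ θ.range) := by exact_mod_cast h.2.2
    rw [hkh, Nat.cast_one, mul_one] at hN
    rw [ht, Nat.cast_one, one_pow, mul_one]
    haveI := hkθ
    have hkθ0 : (Nat.card θ.ker : ℚ_[2]) ≠ 0 := by exact_mod_cast Nat.card_pos.ne'
    refine mul_right_cancel₀ (mul_ne_zero hkθ0 hkg0) ?_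
    linear_combination (Nat.card (coinvariants 2 D.X ⧸ LinearMap.range (bockstein 2 D.X)) : ℚ_[2]) * hu -
      (((u : ℤ_[2]) : ℚ_[2]) * padicRegulator Dh * (2 : ℚ_[2]) ^ (padicValNat 2 W.tamagawaProduct) *
        (Nat.card (AddCommGroup.primaryComponent
          ((integralModelInt W).map (Int.castRingHom (ZMod 2))).toAffine.Point 2) : ℚ_[2]) ^ 2) * hN

set_option maxHeartbeats 2000000 in
/-- **THE OPEN STUB OF C3′ AT `W` ⟺ A STATEMENT IN WHICH `Ш` DOES NOT OCCUR (cell curves: `IsOrdinaryAt W 2`, `E(ℚ)[2] = 0`).**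
`SchneiderLeadingTermFormulaAtTwoSqAt W` (conjunct (3) of T-23008-a = the registered open stub `stub_leadingTermFormulaAtTwo` of line
`birth` v5, read at `W`) holds IFF for the same binders (every cyclotomic datum, every finitely generated torsion strict-at-`∞` dual `D`,
THE canonical `Σ²` height `Dh`, `Reg₂(Dh) ≠ 0`, `Ш(E/ℚ)(2)` finite) and every choice of `e`, `e₀` and of an injection
`κ : M ↪ Sel_{2^∞}(E/ℚ)` with cokernel of order `#Ш(E/ℚ)(2)`, the derived Kummer map `θ = φ_{Sel} ∘ e ∘ s₀ ∘ e₀ ∘ κ` has finite kernel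
and cokernel and **`#ker θ · #(A₀/Sel₀) · (log₂5)^{rank E(ℚ)} = u · #coker θ · Reg₂(Dh) · 2^{v₂(∏c_v)} · #Ẽ(𝔽₂)(2)²`**, `u ∈ ℤ₂ˣ`
(p624996's `schneiderLeadingTermFormulaAtTwoSqAt_iff_eulerCharAt` ∘ `eulerCharAt_iff_shaFreeAt`; for `←` the Kummer image
`N ≤ Sel_{2^∞}(E/ℚ)` with its inclusion, `exists_kummerToSelmer`). READING: `Ш` has cancelled out of the one open obligation of
C3′; what is open at `2` is Greenberg's `#(A₀/Sel₀)` against the local Euler factors (Lemmas 4.4/4.7) times the derived-height index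
of `θ` against `Reg₂/(log₂5)^r` («algebraic height = Bockstein», not in print at `2` over `ℚ`). Closes nothing; BSD is not proved.
[cite: CoatesSchneiderSujatha2003, p. 204 (Case 2)] [cite: GreenbergLNM1716, §4 Thm. 4.1, Lemmas 4.2–4.7 (pp. 102–108)]
[cite: PerrinRiou1992, §3.4] [cite: BalakrishnanMullerStein2015, Thm. 1.7 (3) (printed for p > 2)] -/
theorem schneiderLeadingTermFormulaAtTwoSqAt_iff_shaFreeAt (hK : ∀ P : W.toAffine.Point, 2 • P = 0 → P = 0)
    (hord : IsOrdinaryAt W 2) :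
    Summit.BirchSwinnertonDyer.Rank1Residual.F1Sign2.SchneiderLeadingTermFormulaAtTwoSqAt W ↔
    (∀ (κ : ZpExtension ℚ 2) (γ : Field.absoluteGaloisGroup ℚ),
        κ.IsCyclotomic → κ.IsTopGenerator γ → IsCyclotomicVariable 2 γ →
      ∀ (D : W.SelmerDualData κ γ) [Module.Finite (IwasawaAlgebra 2) D.X], D.IsTorsion →
      ∀ (Dh : PAdicHeightData W 2), Dh.IsCanonicalSq →
        SchneiderConjecture Dh → Finite (AddCommGroup.primaryComponent W.sha 2) →
      ∀ (e : ↥(W.selmerInfty κ ⊓ W.layerInvariants κ 0) ≃+ ↥(endInvariants (W.conjSelmerInfty κ γ - 1)))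
        (e₀ : ↥(W.selmerGroupPInfty 2) ≃+ ↥(W.selmerLayer κ 0))
        (M : Type) [AddCommGroup M] (kS : M →+ ↥(W.selmerGroupPInfty 2)), Function.Injective kS →
        Nat.card (↥(W.selmerGroupPInfty 2) ⧸ kS.range) = Nat.card (AddCommGroup.primaryComponent W.sha 2) →
      ∀ (θ : M →+ EndCoinvariants (W.conjSelmerInfty κ γ - 1)),
        θ = (W.selmerInftyEulerMap κ γ).comp
          (((e : ↥(W.selmerInfty κ ⊓ W.layerInvariants κ 0) →+ ↥(endInvariants (W.conjSelmerInfty κ γ - 1))).comp (W.sMap κ 0)).comp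
            ((e₀ : ↥(W.selmerGroupPInfty 2) →+ ↥(W.selmerLayer κ 0)).comp kS)) →
        Finite θ.ker ∧ Finite (EndCoinvariants (W.conjSelmerInfty κ γ - 1) ⧸ θ.range) ∧
        ∃ u : ℤ_[2]ˣ,
          (Nat.card θ.ker : ℚ_[2]) * Nat.card (W.KerG κ 0) * padicLog 2 (cyclotomicGenerator 2) ^ W.mordellWeilRank =
            ((u : ℤ_[2]) : ℚ_[2]) * Nat.card (EndCoinvariants (W.conjSelmerInfty κ γ - 1) ⧸ θ.range) * padicRegulator Dh *
              (2 : ℚ_[2]) ^ (padicValNat 2 W.tamagawaProduct) *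
              (Nat.card (AddCommGroup.primaryComponent
                ((integralModelInt W).map (Int.castRingHom (ZMod 2))).toAffine.Point 2) : ℚ_[2]) ^ 2) := by
  refine (Summit.BirchSwinnertonDyer.BirchSwinnertonDyer.Theorems.AlignedTransportAtTwoEulerCharAtTwo.schneiderLeadingTermFormulaAtTwoSqAt_iff_eulerCharAt
    W).trans ⟨?_, ?_⟩
  · intro h κ γ hκ hγ hγ' D _ hX Dh hDh hS hSha e e₀ M _ kS hkS hkS' θ hθ
    exact (eulerCharAt_iff_shaFreeAt W hK hord hκ hγ D hX Dh hSha e e₀ kS hkS hkS' θ hθ).mp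
      (h hord.1 hord.2 κ γ hκ hγ hγ' D hX Dh hDh hS hSha)
  · intro h hg ho κ γ hκ hγ hγ' D _ hX Dh hDh hS hSha
    obtain ⟨e, -⟩ := exists_invariantsZero_addEquiv (γ := γ) W κ hγ
    obtain ⟨e₀, -⟩ := exists_selmerLayerZero_addEquiv (p := 2) W κ
    -- the Kummer image `N = κ(E(ℚ) ⊗ ℚ₂/ℤ₂) ≤ Sel_{2^∞}(E/ℚ)` with its inclusion (abstract carrier: no instance transport)
    obtain ⟨kS, -, -, hkS'⟩ := exists_kummerToSelmer (p := 2) W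
    obtain ⟨N, hN⟩ : ∃ N : AddSubgroup ↥(W.selmerGroupPInfty 2),
        Nat.card (↥(W.selmerGroupPInfty 2) ⧸ N) = Nat.card (AddCommGroup.primaryComponent W.sha 2) := ⟨_, hkS'⟩
    have hN' : Nat.card (↥(W.selmerGroupPInfty 2) ⧸ N.subtype.range) =
        Nat.card (AddCommGroup.primaryComponent W.sha 2) := by
      rw [AddSubgroup.range_subtype]; exact hN
    exact (eulerCharAt_iff_shaFreeAt W hK hord hκ hγ D hX Dh hSha e e₀ N.subtype N.subtype_injective hN' _ rfl).mpr
      (h κ γ hκ hγ hγ' D hX Dh hDh hS hSha e e₀ _ N.subtype N.subtype_injective hN' _ rfl)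

end AtTwo

end Summit.BirchSwinnertonDyer.BirchSwinnertonDyer.Theorems.AlignedTransportAtTwoEulerCharAtTwoAssemblyKummer

end
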